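import Summits.QuantumFields.YangMills.Theorems.BalabanUVNodesN15PerCubeGreenTwoGridEntryThreeAlgebra
import Summits.QuantumFields.YangMills.Theorems.BalabanUVNodesN15PerCubeGreenTwoGridKnitDefect
import Summits.QuantumFields.YangMills.Theorems.BalabanUVNodesN15PerCubeGreenKnit
import Summits.QuantumFields.YangMills.Theorems.BalabanUVNodesN15PerCubeGreenFineKnit
import HarnessLib

/-!
# N15 = NE2, road (c) — PROGRAMME (PC), ENTRY 3 OF (3.42) (`Δ_{R_U}G′`) AT TWO SPACINGS WITHOUT JETS, KNIT LEVEL: the two-grid η-defect of `Δ_{R_U′}∘scGlued′` against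
# `Δ_{R_U}∘scGlued` through the covariant transport `τ_S`, from n15-c∕339 (entry 0), dag-n15-w3 52 ∕ n15-c∕262–263 (decay + the exact inverse identities on each grid) and
# n15-c∕376 (the exact-equation algebra) — the summand `P` and its located two-grid row `𝔇_{τ_S}(P′, P)` DISPLAYED (produced for Bałaban's `P` by n15-c∕377∕379) (dag-n15-c g34, n15-c∕380)

Cell `pub-ymgap`, seat `pub-ymgap-dag-n15-c` (generation g34; R134 (a) seat, strategy s1 «first missing estimate»; HUMAN RULING D-0062; chair R424 venue).
`bears_on: R4∕N15 · K3⁸ SpineGivenEndpointR13SepCoPHV (stmt-QuantumFields-27366)`; filed `--kind proof --supports stmt-QuantumFields-27366 --as helper` — COUNT-NEUTRAL.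
ONE theorem, 0 `def`, 0 `sorry`.  Imports BY NAME n15-c∕376 `…EntryThreeAlgebra` (`hasMaj_idef_entryThree`), n15-c∕339 `…TwoGridKnitDefect` (`uN_idef_scGlued_tr`), n15-c∕262 `…PerCubeGreenKnit`
(`uN_scGlued_spec`), n15-c∕263 `…PerCubeGreenFineKnit` (`uN_scGlued'_spec`); [B6] `triangle254_unitTorusGeo`, `rowSum_unitTorusGeo` BY NAME.  Nothing in the tree is modified, no landed name re-declared;
the statement is n15-c∕339's binder block VERBATIM (generator HOME `tools/g34/build_H13.py` reads it from the tree) with `0 ≤ θ_F` added and the entry-3 rows appended.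

THE THEOREM `uN_idef_entryThree_tr`.  For odd `L ≥ 7`, `a₀ > 0`, a colour index `ι`: there are `δ, w₀, R₀, θ₀, ρ₀ > 0` and `D, B, c ≥ 0` such that, under EXACTLY the hypotheses of
n15-c∕339 (unitary fine cube gauges `u′_k`, coarse gauges induced `u′_k∘σ`, unitary `U′`, any `U`, abstract summands `P, P′` with the conjugation laws, the (3.35) letters on the cut
boxes of both grids, the fits `hfitC hfitA hDNV hDfarN`, the cut ∕ far rows of `N_V, N′_V` at rate `δ`, the budget `r_V(1+|J⊕J|) + R_N ≤ R₀`, `θ_F ≤ θ₀`, the column letter `ρ`, the locality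
row of `P`) plus `0 ≤ θ_F`, and given two DISPLAYED rows — the fine summand `P′ ≤ a_P·e^{−δd}` (target blocks) and its located two-grid defect `𝔇_{τ_S}(P′, P) ≤ o_P·e^{−δd}` —
`𝔇_{τ_S}(Δ_{R_U′}∘scGlued′, Δ_{R_U}∘scGlued) ≤ (a_P·D·((L^k)^{−1∕4} + o + s + r_D)·c + o_P·B·c)·e^{−ρ₀|y−y′|_T}` blockwise, `s = (1+ρ)^{(d+1)(L^r−1)} − 1`.  MECHANISM: the exact equations
`(Δ_{R_U′} + P′)∘scGlued′ = 1`, `(Δ_{R_U} + P)∘scGlued = 1` (262∕263) turn the entry-3 defect into `−(P′∘𝔇(G′,G) + 𝔇(P′,P)∘G)` (376 `idef_entryThree_eq`); 339 bounds `𝔇(G′,G)`, 262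
bounds `G`; `hasMaj_comp_exp` twice (376 `hasMaj_idef_entryThree`).  CONSTANTS: `δ = max(δ₃₃₉, δ₂₆₂, δ₂₆₃)` (the displayed rows are asked at the LARGEST rate and weakened inside),
`w₀ = max`, `R₀, θ₀ = min`, `D = max(D₃₃₉, 0)`, `B = B₂₆₂`, `ρ₀ = σ = min(δ₃₃₉, δ₂₆₂)∕32`, `c = K_{d+1}(σ)` ([B6] (2.61)).

HONEST FRAMING ∕ LIMITS.  Bookkeeping over landed theorems in the MODEL two-grid setting (King tori, one cube scale, `P`, `N_V` abstract): for Bałaban's summand `P = a·Q′_TᵀQ′_T` the two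
displayed rows are n15-c∕377 `hasMaj_scP'_of_unitary` and n15-c∕379 `hasMaj_idef_ctauS_scP` (cube-gauge letters `ρ, b` on the plateau blocks), and the remaining displayed data are
produced from ONE (3.35)∕[B11] (9) datum per cube by n15-c∕340–374's chain — that instantiation (the entry-3 twin of n15-c∕340∕344∕371∕374) is NOT in this file.  Entry 3 only; entries
1–2 of (3.42) (`∇G′`, `S̄_h∇G′`) at two spacings need the jet editions (PCE-DESIGN §5) — NOT here.  The SHAPE of [B9] Thm 3.14 ∕ (3.42) for `G′`, NOT the printed theorem; nothing of
[B5]∕[B6]∕[B7]∕[B9] asserted.  NE2⁺ NOT PRINTED ∕ NOT proved; N15 of record untouched (DISCHARGED AS CONSUMED, p687738); K3⁸ OPEN; counts of record UNMOVED (typed 28∕28 · discharged 8∕27);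
one finite 𝕋⁴ at fixed ε per index — NOT infinite volume, NOT OS on ℝ⁴, NOT a mass gap, NOT Clay.  Restate-immune (no Theses import).
-/

noncomputable section

open scoped BigOperators Matrix Matrix.Norms.Frobenius

namespace Summit.QuantumFields.YangMills.BalabanUVNodes.N15.Gluing

open Real
open Literature.MathematicalPhysics.QuantumFieldTheory.Balaban1983to89
open Literature.MathematicalPhysics.QuantumFieldTheory.Balaban1983to89.B5Prop11Plancherel (Tor fine unitVec)
open Literature.MathematicalPhysics.QuantumFieldTheory.Balaban1983to89.B11SectG (BlockNorm HasMaj RowSum)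
open Literature.MathematicalPhysics.QuantumFieldTheory.Balaban1983to89.B6RandomWalk (Triangle254)
open Literature.MathematicalPhysics.QuantumFieldTheory.Balaban1983to89.T4EtaRateDefect (idef)
open Literature.MathematicalPhysics.QuantumFieldTheory.Balaban1983to89.T4EtaRateCoeffDefect (pull)
open Literature.MathematicalPhysics.QuantumFieldTheory.Balaban1983to89.B6Prop26Gluing (mulOp mulOp_apply ind ind_nonneg ind_le_one)
open Literature.MathematicalPhysics.QuantumFieldTheory.Balaban1983to89.B6UnitTorusCarrier (unitTorusGeo triangle254_unitTorusGeo rowSum_unitTorusGeo unitTorusGeo_dist_nonneg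
  unitTorusGeo_dist_symm unitTorusGeo_dist_self)
open Literature.MathematicalPhysics.QuantumFieldTheory.Balaban1983to89.B5SiteBridgeP12 (MP)
open Literature.MathematicalPhysics.QuantumFieldTheory.King1986 (aK aK_pos aK_le)
open Literature.MathematicalPhysics.QuantumFieldTheory.King1986.Torus (blockOf tdistT tdistT_nonneg tdistT_symm)
open Literature.Barriers.QuantumFields (traceForm)
open Summit.QuantumFields.YangMills.BalabanUVNodes.N15.BackgroundLayer (fgrad fgradAdj bgrad fgrad_apply fgradAdj_apply bgrad_apply stack projO bgPropV covLapM tCoefA tCoefC unstackM)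
open Summit.QuantumFields.YangMills.BalabanUVNodes.N15.VectorPiece (bshiftEquiv bshiftEquiv_apply kingPr kingPrV tensorId tdistT_blockOf_sub_unitVec_le)
open Summit.QuantumFields.YangMills.BalabanUVNodes.N15.MatrixSpecies (mmulOp coordMat liftBlk liftMap liftEquiv liftEquiv_apply liftEquiv_symm_apply)
open Summit.QuantumFields.YangMills.BalabanUVNodes.N15.TwoGrid (paramsOf chiCube cubeBlocks chiCube_of_not_mem abs_chiCube_le_one)
open Summit.QuantumFields.YangMills.BalabanUVNodes.N15.CurvedSpecies (gaugePair uN_hasMaj_idef_glueInv_smoothCutDressed_localGauges_tr)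
open Summit.QuantumFields.YangMills.BalabanUVNodes.N15.CovLandau (cgrad csavg cGreen bBack flatRowsAll_king)
open Summit.QuantumFields.YangMills.BalabanUVNodes.N15.CovAvg (kingStairT kingSec ctauS blockOf_kingPr ctauS_coordMat_Ad_eq_conj abs_kingStairT_coordMat_Ad_transpose_le_one
  smear_cols_kingStairT_coordMat_Ad_transpose_sub_one_le smear_cols_kingStairT_coordMat_Ad_transpose_sub_one_le_kingPr)

variable {d : ℕ}

section Knit

variable {L : ℕ} [NeZero L]

set_option maxHeartbeats 800000 in
set_option maxRecDepth 2048 in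
/-- ★★★ **ENTRY 3 OF (3.42) AT TWO SPACINGS WITHOUT JETS, KNIT LEVEL** — see the module docstring: n15-c∕339's hypotheses verbatim (+ `0 ≤ θ_F`), two displayed rows of the summand,
conclusion `𝔇_{τ_S}(Δ_{R_U′}∘scGlued′, Δ_{R_U}∘scGlued) ≤ (a_P·D·X·c + o_P·B·c)·e^{−ρ₀|y−y′|_T}`.  MODEL carriers; the SHAPE of [B9] Thm 3.14 ∕ (3.42) entry 3 for `G′`, NOT the printed theorem.
[cite: Balaban1985BackgroundPropagators, Thm 3.14 pp.426–427, (3.42) p.397, (3.24) p.394, (3.34)–(3.35) p.396, (3.62)–(3.65) pp.402–403 (shapes ∕ mechanism); Balaban1985Averaging, (125) p.36 (transport: shape);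
Balaban1984PropagatorsII, Lemma 2.1 (2.61) p.234, (2.133)–(2.136) p.247; King1986, p.664 (pairing)] -/
theorem uN_idef_entryThree_tr (hL : Odd L ∧ 1 < L) (hL7 : 7 ≤ L) {a₀ : ℝ} (ha₀ : 0 < a₀) (ι : Type) [Fintype ι] [DecidableEq ι] :
    ∃ δ w₀ R₀ θ₀ D B c ρ₀ : ℝ, 0 < δ ∧ 0 < R₀ ∧ 0 < θ₀ ∧ 0 < ρ₀ ∧ 0 ≤ D ∧ 0 ≤ B ∧ 0 ≤ c ∧ ∀ (mv kk r : ℕ), 1 ≤ kk → 1 ≤ r → w₀ ≤ ((L ^ mv : ℕ) : ℝ) → ∀ {mm : Type} [Fintype mm] [DecidableEq mm] (e : Matrix mm mm ℂ ≃L[ℝ] (ι → ℝ)), (∀ A B : Matrix mm mm ℂ, traceForm A B = e A ⬝ᵥ e B) → ∀ (u' : (Fin (d + 1) → ZMod (2 * L)) → ScX' d L mv kk r hL → Matrix mm mm ℂ), (∀ k x', (u' k x')ᴴ * u' k x' = 1) → ∀ (U : Fin (d + 1) → ScX d L mv kk hL → Matrix mm mm ℂ) (U' : Fin (d + 1) →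 ScX' d L mv kk r hL → Matrix mm mm ℂ), (∀ μ x', (U' μ x')ᴴ * U' μ x' = 1) → ∀ (P : (ScX d L mv kk hL × ι → ℝ) →ₗ[ℝ] (ScX d L mv kk hL × ι → ℝ)) (P' : (ScX' d L mv kk r hL × ι → ℝ) →ₗ[ℝ] (ScX' d L mv kk r hL × ι → ℝ)) (NV : (Fin (d + 1) → ZMod (2 * L)) → (ScX d L mv kk hL × ι → ℝ) →ₗ[ℝ] (ScX d L mv kk hL × ι → ℝ)) (NV' : (Fin (d + 1) → ZMod (2 * L)) → (ScX' d L mv kk r hL × ι → ℝ) →ₗ[ℝ] (ScX' d L mv kk r hL × ι → ℝ)) (rV RN θF rD oV oN o ρ : ℝ), 0 ≤ rV → 0 ≤ RN → 0 ≤ rD → 0 ≤ oV → 0 ≤ oN → 0 ≤ ρ → 0 ≤ θF → rV * (1 + Fintype.card (Fin (d + 1) ⊕ Fin (d + 1))) + RN ≤ R₀ → oV * (1 + Fintype.card (Fin (d + 1) ⊕ Fin (d + 1))) + oN ≤ o → θF ≤ θ₀ →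
        (∀ k, mmulOp (fun x => coordMat e (ContinuousLinearMap.mulLeftRight ℝ (Matrix mm mm ℂ) (u' k (kingSec (cvM d L mv kk hL) L kk r x)) (u' k (kingSec (cvM d L mv kk hL) L kk r x))ᴴ)) ∘ₗ P ∘ₗ mmulOp (fun x => (coordMat e (ContinuousLinearMap.mulLeftRight ℝ (Matrix mm mm ℂ) (u' k (kingSec (cvM d L mv kk hL) L kk r x)) (u' k (kingSec (cvM d L mv kk hL) L kk r x))ᴴ))ᵀ) = (scQQ d L mv kk hL (aK a₀ (L : ℝ) kk * (((L ^ kk : ℕ) : ℝ)) ^ (d + 1)) ι) - NV k) → (∀ k, mmulOp (fun x' => coordMat e (ContinuousLinearMap.mulLeftRight ℝ (Matrix mm mm ℂ) (u' k x') (u' k x')ᴴ)) ∘ₗ P' ∘ₗ mmulOp (fun x' => (coordMat e (ContinuousLinearMap.mulLeftRight ℝ (Matrix mm mm ℂ) (u' k x') (u' k x')ᴴ))ᵀ) = (scQQ' d L mv kk r hL (aK a₀ (L : ℝ) (r + kk) * (((L ^ r * L ^ kk : ℕ) : ℝ)) ^ (d + 1)) ι) - NV' k) → (∀ k x, scChi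 d L mv kk hL k x ≠ 0 → ∀ i, ∑ j, |tCoefC ((((L ^ kk : ℕ) : ℝ))⁻¹) (gaugePair (scShift d L mv kk hL) fun μ x => coordMat e (ContinuousLinearMap.mulLeftRight ℝ (Matrix mm mm ℂ) (u' k (kingSec (cvM d L mv kk hL) L kk r x) * U μ x * (u' k (kingSec (cvM d L mv kk hL) L kk r (scShift d L mv kk hL μ x)))ᴴ) (u' k (kingSec (cvM d L mv kk hL) L kk r x) * U μ x * (u' k (kingSec (cvM d L mv kk hL) L kk r (scShift d L mv kk hL μ x)))ᴴ)ᴴ)) x i j| ≤ rV) →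
        (∀ k j' x, scChi d L mv kk hL k x ≠ 0 → ∀ i, ∑ j, |tCoefA ((((L ^ kk : ℕ) : ℝ))⁻¹) (gaugePair (scShift d L mv kk hL) fun μ x => coordMat e (ContinuousLinearMap.mulLeftRight ℝ (Matrix mm mm ℂ) (u' k (kingSec (cvM d L mv kk hL) L kk r x) * U μ x * (u' k (kingSec (cvM d L mv kk hL) L kk r (scShift d L mv kk hL μ x)))ᴴ) (u' k (kingSec (cvM d L mv kk hL) L kk r x) * U μ x * (u' k (kingSec (cvM d L mv kk hL) L kk r (scShift d L mv kk hL μ x)))ᴴ)ᴴ)) j' x i j| ≤ rV) → (∀ k x', scChi' d L mv kk r hL k x' ≠ 0 → ∀ i, ∑ j, |tCoefC ((((L ^ r * L ^ kk : ℕ) : ℝ))⁻¹) (gaugePair (scShift' d L mv kk r hL) fun μ x' => coordMat e (ContinuousLinearMap.mulLeftRight ℝ (Matrix mm mm ℂ) (u' k x' * U' μ x' * (u' k (scShift' d L mv kk r hL μ x'))ᴴ) (u' k x' * U' μ x' * (u' k (scShift' d L mv kk r hL μ x'))ᴴ)ᴴ)) x' i j| ≤ rV) → (∀ k j' x', scChi'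 d L mv kk r hL k x' ≠ 0 → ∀ i, ∑ j, |tCoefA ((((L ^ r * L ^ kk : ℕ) : ℝ))⁻¹) (gaugePair (scShift' d L mv kk r hL) fun μ x' => coordMat e (ContinuousLinearMap.mulLeftRight ℝ (Matrix mm mm ℂ) (u' k x' * U' μ x' * (u' k (scShift' d L mv kk r hL μ x'))ᴴ) (u' k x' * U' μ x' * (u' k (scShift' d L mv kk r hL μ x'))ᴴ)ᴴ)) j' x' i j| ≤ rV) →
        (∀ k x' i, ∑ j, |(scChi' d L mv kk r hL k x' • tCoefC ((((L ^ r * L ^ kk : ℕ) : ℝ))⁻¹) (gaugePair (scShift' d L mv kk r hL) fun μ x' => coordMat e (ContinuousLinearMap.mulLeftRight ℝ (Matrix mm mm ℂ) (u' k x' * U' μ x' * (u' k (scShift' d L mv kk r hL μ x'))ᴴ) (u' k x' * U' μ x' * (u' k (scShift' d L mv kk r hL μ x'))ᴴ)ᴴ)) x') i j - (scChi d L mv kk hL k ((kingPr L kk r (cvM d L mv kk hL)) x') • tCoefC ((((L ^ kk : ℕ) : ℝ))⁻¹) (gaugePair (scShift d L mv kk hL) fun μ x => coordMat e (ContinuousLinearMap.mulLeftRight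 ℝ (Matrix mm mm ℂ) (u' k (kingSec (cvM d L mv kk hL) L kk r x) * U μ x * (u' k (kingSec (cvM d L mv kk hL) L kk r (scShift d L mv kk hL μ x)))ᴴ) (u' k (kingSec (cvM d L mv kk hL) L kk r x) * U μ x * (u' k (kingSec (cvM d L mv kk hL) L kk r (scShift d L mv kk hL μ x)))ᴴ)ᴴ)) ((kingPr L kk r (cvM d L mv kk hL)) x')) i j| ≤ oV) →
        (∀ k j' x' i, ∑ j, |(scChi' d L mv kk r hL k x' • tCoefA ((((L ^ r * L ^ kk : ℕ) : ℝ))⁻¹) (gaugePair (scShift' d L mv kk r hL) fun μ x' => coordMat e (ContinuousLinearMap.mulLeftRight ℝ (Matrix mm mm ℂ) (u' k x' * U' μ x' * (u' k (scShift' d L mv kk r hL μ x'))ᴴ) (u' k x' * U' μ x' * (u' k (scShift' d L mv kk r hL μ x'))ᴴ)ᴴ)) j' x') i j - (scChi d L mv kk hL k ((kingPr L kk r (cvM d L mv kk hL)) x') • tCoefA ((((L ^ kk : ℕ) : ℝ))⁻¹) (gaugePair (scShift d L mv kk hL) fun μ x => coordMat e (ContinuousLinearMap.mulLeftRight ℝ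 (Matrix mm mm ℂ) (u' k (kingSec (cvM d L mv kk hL) L kk r x) * U μ x * (u' k (kingSec (cvM d L mv kk hL) L kk r (scShift d L mv kk hL μ x)))ᴴ) (u' k (kingSec (cvM d L mv kk hL) L kk r x) * U μ x * (u' k (kingSec (cvM d L mv kk hL) L kk r (scShift d L mv kk hL μ x)))ᴴ)ᴴ)) j' ((kingPr L kk r (cvM d L mv kk hL)) x')) i j| ≤ oV) → (∀ k, HasMaj (ScNorm d L mv kk hL ι) (ScNorm d L mv kk hL ι) (mulOp (fun p : ScX d L mv kk hL × ι => scPsi d L mv kk hL k p.1) ∘ₗ NV k ∘ₗ mulOp (fun p : ScX d L mv kk hL × ι => scChi d L mv kk hL k p.1)) (fun y y' => RN * Real.exp (-(δ * (unitTorusGeo L kk (cvM d L mv kk hL)).dist y y')))) →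
        (∀ k, HasMaj (ScNorm' d L mv kk r hL ι) (ScNorm' d L mv kk r hL ι) (mulOp (fun p : ScX' d L mv kk r hL × ι => scPsi' d L mv kk r hL k p.1) ∘ₗ NV' k ∘ₗ mulOp (fun p : ScX' d L mv kk r hL × ι => scChi' d L mv kk r hL k p.1)) (fun y y' => RN * Real.exp (-(δ * (unitTorusGeo L kk (cvM d L mv kk hL)).dist y y')))) → (∀ k, HasMaj (ScNorm d L mv kk hL ι) (BlockNorm.ofBlocks (unitTorusGeo L kk (cvM d L mv kk hL)) (liftBlk (scBlk d L mv kk hL ∘ kingPr L kk r (cvM d L mv kk hL)) ι)) (idef (pull (liftMap (kingPr L kk r (cvM d L mv kk hL)) ι)) (pull (liftMap (kingPr L kk r (cvM d L mv kk hL)) ι)) (mulOp (fun p : ScX' d L mv kk r hL × ι => scPsi' d L mv kk r hL k p.1) ∘ₗ NV' k ∘ₗ mulOp (fun p : ScX' d L mv kk r hL × ι => scChi' d L mv kk r hL k p.1)) (mulOp (fun p : ScX d L mv kk hL × ι => scPsi d L mv kk hL k p.1) ∘ₗ NV k ∘ₗ mulOp (fun p : ScX d L mv kk hL × ι => scChi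 d L mv kk hL k p.1))) (fun y y' => oN * Real.exp (-(δ * (unitTorusGeo L kk (cvM d L mv kk hL)).dist y y')))) → (∀ k, HasMaj (ScNorm d L mv kk hL ι) (ScNorm d L mv kk hL ι) ((LinearMap.id - mulOp (fun p : ScX d L mv kk hL × ι => scPsi d L mv kk hL k p.1)) ∘ₗ NV k ∘ₗ mulOp (fun p : ScX d L mv kk hL × ι => scChi d L mv kk hL k p.1)) (fun y y' => θF * Real.exp (-(δ * (unitTorusGeo L kk (cvM d L mv kk hL)).dist y y')))) →
        (∀ k, HasMaj (ScNorm' d L mv kk r hL ι) (ScNorm' d L mv kk r hL ι) ((LinearMap.id - mulOp (fun p : ScX' d L mv kk r hL × ι => scPsi' d L mv kk r hL k p.1)) ∘ₗ NV' k ∘ₗ mulOp (fun p : ScX' d L mv kk r hL × ι => scChi' d L mv kk r hL k p.1)) (fun y y' => θF * Real.exp (-(δ * (unitTorusGeo L kk (cvM d L mv kk hL)).dist y y')))) → (∀ k, HasMaj (ScNorm d L mv kk hL ι) (BlockNorm.ofBlocks (unitTorusGeo L kk (cvM d L mv kk hL)) (liftBlk (scBlk d L mv kk hL ∘ kingPr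 L kk r (cvM d L mv kk hL)) ι)) (idef (pull (liftMap (kingPr L kk r (cvM d L mv kk hL)) ι)) (pull (liftMap (kingPr L kk r (cvM d L mv kk hL)) ι)) ((LinearMap.id - mulOp (fun p : ScX' d L mv kk r hL × ι => scPsi' d L mv kk r hL k p.1)) ∘ₗ NV' k ∘ₗ mulOp (fun p : ScX' d L mv kk r hL × ι => scChi' d L mv kk r hL k p.1)) ((LinearMap.id - mulOp (fun p : ScX d L mv kk hL × ι => scPsi d L mv kk hL k p.1)) ∘ₗ NV k ∘ₗ mulOp (fun p : ScX d L mv kk hL × ι => scChi d L mv kk hL k p.1))) (fun y y' => rD * Real.exp (-(δ * (unitTorusGeo L kk (cvM d L mv kk hL)).dist y y')))) →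
        -- the (3.35) COLUMN letter of `Ad(u′_kU′u′_kᴴ)` on the plateau cube of `k`, and the locality row of `P`
        (∀ k μ y', scBlk' d L mv kk r hL y' ∈ cvSk d L mv kk hL k → ∀ j, ∑ i, |(coordMat e (ContinuousLinearMap.mulLeftRight ℝ (Matrix mm mm ℂ) (u' k y' * U' μ y' * (u' k (y' + unitVec (fine (L ^ r * L ^ kk) (cvM d L mv kk hL)) μ))ᴴ) (u' k y' * U' μ y' * (u' k (y' + unitVec (fine (L ^ r * L ^ kk) (cvM d L mv kk hL)) μ))ᴴ)ᴴ) - 1) i j| ≤ ρ) → (∀ k, mulOp (fun p : ScX d L mv kk hL × ι => 1 - scPsi d L mv kk hL k p.1) ∘ₗ P ∘ₗ mulOp (fun p : ScX d L mv kk hL × ι => scH d L mv kk hL k p.1) = 0) → ∀ (aP oP : ℝ), 0 ≤ aP → 0 ≤ oP →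
        -- the DISPLAYED rows of the summand: the fine summand on the target blocks, and its located two-grid defect through `τ_S`
        HasMaj (BlockNorm.ofBlocks (unitTorusGeo L kk (cvM d L mv kk hL)) (liftBlk (scBlk d L mv kk hL ∘ kingPr L kk r (cvM d L mv kk hL)) ι)) (BlockNorm.ofBlocks (unitTorusGeo L kk (cvM d L mv kk hL)) (liftBlk (scBlk d L mv kk hL ∘ kingPr L kk r (cvM d L mv kk hL)) ι)) P' (fun y y' => aP * Real.exp (-(δ * (unitTorusGeo L kk (cvM d L mv kk hL)).dist y y'))) →
        HasMaj (ScNorm d L mv kk hL ι) (BlockNorm.ofBlocks (unitTorusGeo L kk (cvM d L mv kk hL)) (liftBlk (scBlk d L mv kk hL ∘ kingPr L kk r (cvM d L mv kk hL)) ι)) (idef (ctauS (cvM d L mv kk hL) L kk r (fun μ x' => coordMat e (ContinuousLinearMap.mulLeftRight ℝ (Matrix mm mm ℂ) (U' μ x') (U' μ x')ᴴ))) (ctauS (cvM d L mv kk hL) L kk r (fun μ x' => coordMat e (ContinuousLinearMap.mulLeftRight ℝ (Matrix mm mm ℂ) (U' μ x') (U' μ x')ᴴ))) P' P) (fun y y'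 => oP * Real.exp (-(δ * (unitTorusGeo L kk (cvM d L mv kk hL)).dist y y'))) →
        HasMaj (ScNorm d L mv kk hL ι) (BlockNorm.ofBlocks (unitTorusGeo L kk (cvM d L mv kk hL)) (liftBlk (scBlk d L mv kk hL ∘ kingPr L kk r (cvM d L mv kk hL)) ι))
          (idef (ctauS (cvM d L mv kk hL) L kk r (fun μ x' => coordMat e (ContinuousLinearMap.mulLeftRight ℝ (Matrix mm mm ℂ) (U' μ x') (U' μ x')ᴴ))) (ctauS (cvM d L mv kk hL) L kk r (fun μ x' => coordMat e (ContinuousLinearMap.mulLeftRight ℝ (Matrix mm mm ℂ) (U' μ x') (U' μ x')ᴴ)))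
            (covLapM (scShift' d L mv kk r hL) ((((L ^ r * L ^ kk : ℕ) : ℝ))⁻¹) (gaugePair (scShift' d L mv kk r hL) (fun μ x => coordMat e (ContinuousLinearMap.mulLeftRight ℝ (Matrix mm mm ℂ) (U' μ x) (U' μ x)ᴴ))) ∘ₗ scGlued' d L mv kk r hL (aK a₀ (L : ℝ) (r + kk) * (((L ^ r * L ^ kk : ℕ) : ℝ)) ^ (d + 1)) ((((L ^ r * L ^ kk : ℕ) : ℝ))⁻¹) ι e u' U' P' NV')
            (covLapM (scShift d L mv kk hL) ((((L ^ kk : ℕ) : ℝ))⁻¹) (gaugePair (scShift d L mv kk hL) (fun μ x => coordMat e (ContinuousLinearMap.mulLeftRight ℝ (Matrix mm mm ℂ) (U μ x) (U μ x)ᴴ))) ∘ₗ scGlued d L mv kk hL (aK a₀ (L : ℝ) kk * (((L ^ kk : ℕ) : ℝ)) ^ (d + 1)) ((((L ^ kk : ℕ) : ℝ))⁻¹) ι e (fun k x => u' k (kingSec (cvM d L mv kk hL) L kk r x)) U P NV))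
          (fun y y' => (aP * (D * (((L : ℝ) ^ kk) ^ (-(1 / 4 : ℝ)) + (o + (((1 + ρ) ^ ((d + 1) * (L ^ r - 1)) - 1) + rD)))) * c + oP * B * c) * Real.exp (-(ρ₀ * (unitTorusGeo L kk (cvM d L mv kk hL)).dist y y'))) := by
  obtain ⟨δ₁, w₁, R₁, θ₁, D₁, hδ₁, hR₁, hθ₁, H₁⟩ := uN_idef_scGlued_tr (d := d) hL hL7 ha₀ ι
  obtain ⟨δ₂, w₂, R₂, θ₂, B₂, hδ₂, hR₂, hθ₂, hB₂, H₂⟩ := uN_scGlued_spec (d := d) hL hL7 ha₀ ι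
  obtain ⟨δ₃, w₃, R₃, θ₃, B₃, hδ₃, hR₃, hθ₃, -, H₃⟩ := uN_scGlued'_spec (d := d) hL hL7 ha₀ ι
  refine ⟨max δ₁ (max δ₂ δ₃), max w₁ (max w₂ w₃), min R₁ (min R₂ R₃), min θ₁ (min θ₂ θ₃), max D₁ 0, B₂, B4Sect5Proof.latticeConst (d + 1) (min δ₁ δ₂ / 32), min δ₁ δ₂ / 32,
    lt_max_of_lt_left hδ₁, lt_min hR₁ (lt_min hR₂ hR₃), lt_min hθ₁ (lt_min hθ₂ hθ₃), by positivity, le_max_right _ _, hB₂.le, B4Sect5Proof.latticeConst_nonneg (d + 1) (by positivity),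
    fun mv kk r hk hr hw₀ => ?_⟩
  intro mm _ _ e he u' hu' U U' hU' P P' NV NV' rV RN θF rD oV oN o ρ hrV hRN hrD hoV hoN hρ0 hθF0 hRle hole hθle
    hP hP' hCloc hAloc hCloc' hAloc' hfitC hfitA hNVcut hNVcut' hDNV hfarN hfarN' hDfarN hρ hPloc aP oP haP hoP hProw hDProw
  -- thresholds of the three packages
  have hw₁ : w₁ ≤ ((L ^ mv : ℕ) : ℝ) := (le_max_left _ _).trans hw₀
  have hw₂ : w₂ ≤ ((L ^ mv : ℕ) : ℝ) := ((le_max_left _ _).trans (le_max_right _ _)).trans hw₀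
  have hw₃ : w₃ ≤ ((L ^ mv : ℕ) : ℝ) := ((le_max_right _ _).trans (le_max_right _ _)).trans hw₀
  have hR₁le : rV * (1 + Fintype.card (Fin (d + 1) ⊕ Fin (d + 1))) + RN ≤ R₁ := hRle.trans (min_le_left _ _)
  have hR₂le : rV * (1 + Fintype.card (Fin (d + 1) ⊕ Fin (d + 1))) + RN ≤ R₂ := hRle.trans ((min_le_right _ _).trans (min_le_left _ _))
  have hR₃le : rV * (1 + Fintype.card (Fin (d + 1) ⊕ Fin (d + 1))) + RN ≤ R₃ := hRle.trans ((min_le_right _ _).trans (min_le_right _ _))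
  have hθ₁le : θF ≤ θ₁ := hθle.trans (min_le_left _ _)
  have hθ₂le : θF ≤ θ₂ := hθle.trans ((min_le_right _ _).trans (min_le_left _ _))
  have hθ₃le : θF ≤ θ₃ := hθle.trans ((min_le_right _ _).trans (min_le_right _ _))
  have h1 : δ₁ ≤ max δ₁ (max δ₂ δ₃) := le_max_left _ _
  have h2 : δ₂ ≤ max δ₁ (max δ₂ δ₃) := (le_max_left _ _).trans (le_max_right _ _)
  have h3 : δ₃ ≤ max δ₁ (max δ₂ δ₃) := (le_max_right _ _).trans (le_max_right _ _)
  have h116 : δ₁ / 16 ≤ max δ₁ (max δ₂ δ₃) := by linarith only [h1, hδ₁]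
  -- the displayed rows at the largest rate imply them at each package's rate
  have hmono : ∀ (δ' A : ℝ), δ' ≤ max δ₁ (max δ₂ δ₃) → 0 ≤ A → ∀ y y' : Tor (cvM d L mv kk hL),
      A * Real.exp (-(max δ₁ (max δ₂ δ₃) * (unitTorusGeo L kk (cvM d L mv kk hL)).dist y y')) ≤ A * Real.exp (-(δ' * (unitTorusGeo L kk (cvM d L mv kk hL)).dist y y')) := fun δ' A hδ' hA y y' =>
    mul_le_mul_of_nonneg_left (Real.exp_le_exp.mpr (neg_le_neg (mul_le_mul_of_nonneg_right hδ' (unitTorusGeo_dist_nonneg L kk (cvM d L mv kk hL) y y')))) hA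
  -- (1) entry 0 (n15-c∕339)
  have hDG := H₁ mv kk r hk hr hw₁ e he u' hu' U U' hU' P P' NV NV' rV RN θF rD oV oN o ρ hrV hRN hrD hoV hoN hρ0 hR₁le hole hθ₁le hP hP' hCloc hAloc hCloc' hAloc' hfitC hfitA
    (fun k => (hNVcut k).mono (hmono δ₁ RN h1 hRN)) (fun k => (hNVcut' k).mono (hmono δ₁ RN h1 hRN)) (fun k => (hDNV k).mono (hmono δ₁ oN h1 hoN))
    (fun k => (hfarN k).mono (hmono δ₁ θF h1 hθF0)) (fun k => (hfarN' k).mono (hmono δ₁ θF h1 hθF0)) (fun k => (hDfarN k).mono (hmono δ₁ rD h1 hrD)) hρ hPloc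
  -- (2) the coarse Green's function: decay and the exact inverse identity (n15-c∕262)
  obtain ⟨hGrow, -, hinv⟩ := H₂ mv kk hk hw₂ e he (fun k x => u' k (kingSec (cvM d L mv kk hL) L kk r x)) (fun k x => hu' k _) U P NV rV RN θF hrV hRN hθF0 hR₂le hθ₂le hP hCloc hAloc
    (fun k => (hNVcut k).mono (hmono δ₂ RN h2 hRN)) (fun k => (hfarN k).mono (hmono δ₂ θF h2 hθF0))
  -- (3) the fine Green's function: the exact inverse identity (n15-c∕263)
  obtain ⟨-, -, hinv'⟩ := H₃ mv kk r hk hr hw₃ e he u' hu' U' P' NV' rV RN θF hrV hRN hθF0 hR₃le hθ₃le hP' hCloc' hAloc'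
    (fun k => (hNVcut' k).mono (hmono δ₃ RN h3 hRN)) (fun k => (hfarN' k).mono (hmono δ₃ θF h3 hθF0))
  -- (4) the geometry letters and the composition (n15-c∕376)
  have htri : Triangle254 (unitTorusGeo L kk (cvM d L mv kk hL)) := triangle254_unitTorusGeo L kk _
  have hd : ∀ a b : Tor (cvM d L mv kk hL), 0 ≤ (unitTorusGeo L kk (cvM d L mv kk hL)).dist a b := unitTorusGeo_dist_nonneg L kk _
  have hrow : RowSum (unitTorusGeo L kk (cvM d L mv kk hL)) (min δ₁ δ₂ / 32) (B4Sect5Proof.latticeConst (d + 1) (min δ₁ δ₂ / 32)) := rowSum_unitTorusGeo L kk _ (by positivity)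
  have ho0 : 0 ≤ o := le_trans (by positivity) hole
  have hs0 : (0 : ℝ) ≤ (1 + ρ) ^ ((d + 1) * (L ^ r - 1)) - 1 := by
    have := one_le_pow₀ (M₀ := ℝ) (a := 1 + ρ) (le_add_of_nonneg_right hρ0) (n := (d + 1) * (L ^ r - 1)); linarith
  have hX0 : (0 : ℝ) ≤ (((L : ℝ) ^ kk) ^ (-(1 / 4 : ℝ)) + (o + (((1 + ρ) ^ ((d + 1) * (L ^ r - 1)) - 1) + rD))) := by positivity
  have hDG' : HasMaj (ScNorm d L mv kk hL ι) (BlockNorm.ofBlocks (unitTorusGeo L kk (cvM d L mv kk hL)) (liftBlk (scBlk d L mv kk hL ∘ kingPr L kk r (cvM d L mv kk hL)) ι)) (idef (ctauS (cvM d L mv kk hL) L kk r (fun μ x' => coordMat e (ContinuousLinearMap.mulLeftRight ℝ (Matrix mm mm ℂ) (U' μ x') (U' μ x')ᴴ))) (ctauS (cvM d L mv kk hL) L kk r (fun μ x' => coordMat e (ContinuousLinearMap.mulLeftRight ℝ (Matrix mm mm ℂ) (U' μ x') (U' μ x')ᴴ))) (scGlued' d L mv kk r hL (aK a₀ (L :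 ℝ) (r + kk) * (((L ^ r * L ^ kk : ℕ) : ℝ)) ^ (d + 1)) ((((L ^ r * L ^ kk : ℕ) : ℝ))⁻¹) ι e u' U' P' NV') (scGlued d L mv kk hL (aK a₀ (L : ℝ) kk * (((L ^ kk : ℕ) : ℝ)) ^ (d + 1)) ((((L ^ kk : ℕ) : ℝ))⁻¹) ι e (fun k x => u' k (kingSec (cvM d L mv kk hL) L kk r x)) U P NV)) (fun y y' => (max D₁ 0 * (((L : ℝ) ^ kk) ^ (-(1 / 4 : ℝ)) + (o + (((1 + ρ) ^ ((d + 1) * (L ^ r - 1)) - 1) + rD)))) * Real.exp (-(δ₁ / 16 * (unitTorusGeo L kk (cvM d L mv kk hL)).dist y y'))) :=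
    hDG.mono fun y y' => mul_le_mul_of_nonneg_right (mul_le_mul_of_nonneg_right (le_max_left _ _) hX0) (Real.exp_nonneg _)
  have hP'₁ : HasMaj (BlockNorm.ofBlocks (unitTorusGeo L kk (cvM d L mv kk hL)) (liftBlk (scBlk d L mv kk hL ∘ kingPr L kk r (cvM d L mv kk hL)) ι)) (BlockNorm.ofBlocks (unitTorusGeo L kk (cvM d L mv kk hL)) (liftBlk (scBlk d L mv kk hL ∘ kingPr L kk r (cvM d L mv kk hL)) ι)) P' (fun y y' => aP * Real.exp (-(δ₁ / 16 * (unitTorusGeo L kk (cvM d L mv kk hL)).dist y y'))) := hProw.mono (hmono (δ₁ / 16) aP h116 haP)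
  have hDP₁ : HasMaj (ScNorm d L mv kk hL ι) (BlockNorm.ofBlocks (unitTorusGeo L kk (cvM d L mv kk hL)) (liftBlk (scBlk d L mv kk hL ∘ kingPr L kk r (cvM d L mv kk hL)) ι)) (idef (ctauS (cvM d L mv kk hL) L kk r (fun μ x' => coordMat e (ContinuousLinearMap.mulLeftRight ℝ (Matrix mm mm ℂ) (U' μ x') (U' μ x')ᴴ))) (ctauS (cvM d L mv kk hL) L kk r (fun μ x' => coordMat e (ContinuousLinearMap.mulLeftRight ℝ (Matrix mm mm ℂ) (U' μ x') (U' μ x')ᴴ))) P' P) (fun y y' => oP * Real.exp (-(δ₁ / 16 * (unitTorusGeo L kk (cvM d L mv kk hL)).dist y y'))) := hDProw.mono (hmono (δ₁ / 16) oP h116 hoP)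
  have hσρ : min δ₁ δ₂ / 32 + min δ₁ δ₂ / 32 ≤ δ₁ / 16 := by linarith only [min_le_left δ₁ δ₂]
  have hσ₂ : min δ₁ δ₂ / 32 + min δ₁ δ₂ / 32 ≤ δ₂ / 16 := by linarith only [min_le_right δ₁ δ₂]
  have key := hasMaj_idef_entryThree (ctauS (cvM d L mv kk hL) L kk r (fun μ x' => coordMat e (ContinuousLinearMap.mulLeftRight ℝ (Matrix mm mm ℂ) (U' μ x') (U' μ x')ᴴ))) (ctauS (cvM d L mv kk hL) L kk r (fun μ x' => coordMat e (ContinuousLinearMap.mulLeftRight ℝ (Matrix mm mm ℂ) (U' μ x') (U' μ x')ᴴ))) hinv' hinv htri hd hrow haP hB₂.le (mul_nonneg (le_max_right _ _) hX0) hoP (by positivity) (by positivity) hσρ hσρ hσ₂ hP'₁ hGrow hDG' hDP₁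
  refine key.mono fun y y' => le_of_eq ?_
  rw [show ((BlockNorm.ofBlocks (unitTorusGeo L kk (cvM d L mv kk hL)) (liftBlk (scBlk d L mv kk hL ∘ kingPr L kk r (cvM d L mv kk hL)) ι)) : BlockNorm (unitTorusGeo L kk (cvM d L mv kk hL)) _).κ = 1 from rfl, show ((ScNorm d L mv kk hL ι) : BlockNorm (unitTorusGeo L kk (cvM d L mv kk hL)) _).κ = 1 from rfl]
  ring

end Knit

end Summit.QuantumFields.YangMills.BalabanUVNodes.N15.Gluing

end
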